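import Summits.Ventures.HodgeRepro2.T6A2WeilGrading

/-!
# T6A2WeilCoproduct — `m^* = pr₁^* + pr₂^*` on `H¹` of an abelian variety, from the group law

Cell pub-hodge-repro2, Tier 6 (README §10), seat t6-p2 (A2 host side). The eighth display of the A2 glue
(«`m^*` on `H¹` is `φ ↦ φ ⊗ 1 + 1 ⊗ φ`», Hatcher §3.C / Lange §1.1 — the interface's `cop_ι`, the glue's
`hcop_ev`) is a THEOREM on the host Weil cohomology: for the addition `m : B × B → B` with a unit
`e : pt → B` satisfying the two unit laws (`GroupLaw`), every `v ∈ H¹(B)` has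
`m^* v = pr₁^* v + pr₂^* v` (`pullback_m_one`). Proof: Künneth in degree one (`W.bijective_kunnethMap`
at `d = 1`: `H¹(B × B) = pr₁^* H¹(B) + pr₂^* H¹(B)`, using `H⁰(B) = ℚ · 1` from `finrank_obj_zero` and
`one ≠ 0`), then the two sections `x ↦ (x, e)`, `x ↦ (e, x)` of the projections pull `m^* v` back to `v`
(the unit laws) and kill the other summand (`H¹(pt) = 0`: the host's `subsingleton_obj` on the point, for
which `IsSmoothProjective 0 pt` is the host's named Prop `isSmoothProjective_unit`, taken as the binder
`hpt`). On the full ring: `pullF_m_langeMap`. No `sorry`; standard axioms.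
§8(d): uses an L-value-free non-vanishing device: NO.
-/

noncomputable section

namespace Summit.Ventures.HodgeRepro2.T6.WeilInst

open HostAPI.Carriers.AlgebraicGeometry.Motives CategoryTheory Opposite MonoidalCategory
  CartesianMonoidalCategory
open scoped DirectSum

universe u

variable {k : Type u} [Field k] (W : WeilCohomology k ℚ)

section degreeZero

variable (P : SPVar k)

/-- the unit class is non-zero (the trace is onto `ℚ`) -/
theorem one_ne_zero_weil : W.one P.X ≠ 0 := by
  intro h
  obtain ⟨x, hx⟩ := (W.bijective_trace P.smooth).2 1
  have hx0 : x = 0 := by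
    rw [← W.one_cup P.smooth (by omega : 0 + 2 * P.n = 2 * P.n) x, h]
    simp
  rw [hx0, map_zero] at hx
  exact zero_ne_one hx

/-- `H⁰(X) = ℚ · 1` -/
theorem exists_eq_smul_one (a : W.obj P.X 0) : ∃ r : ℚ, a = r • W.one P.X := by
  haveI := W.finite_obj P.smooth 0
  obtain ⟨r, hr⟩ := (finrank_eq_one_iff_of_nonzero' (W.one P.X) (one_ne_zero_weil W P)).1
    (W.finrank_obj_zero P.smooth) a
  exact ⟨r, hr.symm⟩

end degreeZero

section kunnethOne

variable (P : SPVar k)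

/-- KÜNNETH IN DEGREE ONE: `H¹(X × X) = pr₁^* H¹(X) + pr₂^* H¹(X)`. -/
theorem exists_eq_pullback_fst_add_pullback_snd (hPP : IsSmoothProjective (P.n + P.n) (P.X ⊗ P.X))
    (w : W.obj (P.X ⊗ P.X) 1) :
    ∃ a b : W.obj P.X 1, w = W.pullback (fst P.X P.X) 1 a + W.pullback (snd P.X P.X) 1 b := by
  classical
  obtain ⟨t, rfl⟩ := (W.bijective_kunnethMap P.smooth P.smooth 1).2 w
  induction t using DirectSum.induction_on with
  | zero => exact ⟨0, 0, by simp⟩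
  | add t₁ t₂ h₁ h₂ =>
    obtain ⟨a₁, b₁, h₁⟩ := h₁
    obtain ⟨a₂, b₂, h₂⟩ := h₂
    exact ⟨a₁ + a₂, b₁ + b₂, by rw [map_add, h₁, h₂, map_add, map_add]; abel⟩
  | of ij t =>
    obtain ⟨⟨i, j⟩, hij⟩ := ij
    have hij' : i + j = 1 := Finset.HasAntidiagonal.mem_antidiagonal.mp hij
    simp only [PreWeilCohomology.kunnethMap]
    rw [← DirectSum.lof_eq_of ℚ, DirectSum.toModule_lof]
    induction t using TensorProduct.induction_on with
    | zero => exact ⟨0, 0, by simp⟩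
    | add t₁ t₂ h₁ h₂ =>
      obtain ⟨a₁, b₁, h₁⟩ := h₁
      obtain ⟨a₂, b₂, h₂⟩ := h₂
      exact ⟨a₁ + a₂, b₁ + b₂, by rw [map_add, h₁, h₂, map_add, map_add]; abel⟩
    | tmul a b =>
      rw [TensorProduct.lift.tmul]
      change ∃ a' b', W.externalCup P.X P.X hij' a b = _
      rcases Nat.le_one_iff_eq_zero_or_eq_one.1 (show i ≤ 1 by omega) with hi | hi
      · -- `i = 0`, `j = 1`: `a = r • 1`
        subst hi
        have hj : j = 1 := by omega
        subst hj
        obtain ⟨r, rfl⟩ := exists_eq_smul_one W P a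
        refine ⟨0, r • b, ?_⟩
        rw [PreWeilCohomology.externalCup, LinearMap.compl₂_apply, LinearMap.comp_apply, map_smul,
          W.map_one hPP P.smooth, LinearMap.map_smul₂, W.one_cup hPP, map_zero, map_smul, zero_add]
      · -- `i = 1`, `j = 0`: `b = r • 1`
        subst hi
        have hj : j = 0 := by omega
        subst hj
        obtain ⟨r, rfl⟩ := exists_eq_smul_one W P b
        refine ⟨r • a, 0, ?_⟩
        rw [PreWeilCohomology.externalCup, LinearMap.compl₂_apply, LinearMap.comp_apply, map_smul,
          W.map_one hPP P.smooth, map_smul, map_zero, add_zero, map_smul]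
        congr 1
        rw [W.cup_comm hPP hij' (by omega : 0 + 1 = 1) _ (W.one (P.X ⊗ P.X))]
        simp only [Nat.cast_one, Nat.cast_zero, mul_zero, Int.negOnePow_zero, Units.val_one, one_smul]
        exact W.one_cup hPP _ _

end kunnethOne

section groupLaw

/-- THE UNIT OF THE GROUP LAW OF `B`: a point `e : pt → B` with `m ∘ (id, e) = id = m ∘ (e, id)` (the unit
laws of the abelian variety; the lead's `AbelianVariety` carries them as `MonObj` data). No field asserts a
printed theorem. -/
structure GroupLaw (D : SituationData k) where
  /-- the unit section `e : pt → B` -/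
  e : 𝟙_ (SchemeOver k) ⟶ D.B.X
  /-- `m ∘ (id, e) = id` -/
  unit_right : lift (𝟙 D.B.X) (toUnit D.B.X ≫ e) ≫ D.m = 𝟙 D.B.X
  /-- `m ∘ (e, id) = id` -/
  unit_left : lift (toUnit D.B.X ≫ e) (𝟙 D.B.X) ≫ D.m = 𝟙 D.B.X

variable (D : SituationData k)

/-- `H¹(pt) = 0`: pull-backs along a map through the point vanish in degree one -/
theorem pullback_through_unit_one (hpt : IsSmoothProjective 0 (𝟙_ (SchemeOver k))) {X : SchemeOver k}
    (f : X ⟶ 𝟙_ (SchemeOver k)) (g : 𝟙_ (SchemeOver k) ⟶ D.B.X) (v : W.obj D.B.X 1) :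
    W.pullback (f ≫ g) 1 v = 0 := by
  rw [W.pullback_comp, LinearMap.comp_apply]
  haveI := W.subsingleton_obj hpt (i := 1) (by omega)
  rw [Subsingleton.elim (W.pullback g 1 v) 0, map_zero]

/-- THE COPRODUCT ON `H¹`: `m^* v = pr₁^* v + pr₂^* v`. -/
theorem pullback_m_one (G : GroupLaw D) (hpt : IsSmoothProjective 0 (𝟙_ (SchemeOver k))) (v : W.obj D.B.X 1) :
    W.pullback D.m 1 v = W.pullback (fst D.B.X D.B.X) 1 v + W.pullback (snd D.B.X D.B.X) 1 v := by
  obtain ⟨a, b, hab⟩ := exists_eq_pullback_fst_add_pullback_snd W D.B D.smoothBB (W.pullback D.m 1 v)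
  -- the section `x ↦ (x, e)` recovers `v` and `a`
  have ha : a = v := by
    have h := congrArg (W.pullback (lift (𝟙 D.B.X) (toUnit D.B.X ≫ G.e)) 1) hab
    rw [pullback_pullback, G.unit_right, W.pullback_id, LinearMap.id_apply, map_add, pullback_pullback,
      pullback_pullback, lift_fst, lift_snd, W.pullback_id, LinearMap.id_apply,
      pullback_through_unit_one W D hpt, add_zero] at h
    exact h.symm
  -- the section `x ↦ (e, x)` recovers `v` and `b`
  have hb : b = v := by
    have h := congrArg (W.pullback (lift (toUnit D.B.X ≫ G.e) (𝟙 D.B.X)) 1) hab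
    rw [pullback_pullback, G.unit_left, W.pullback_id, LinearMap.id_apply, map_add, pullback_pullback,
      pullback_pullback, lift_fst, lift_snd, W.pullback_id, LinearMap.id_apply,
      pullback_through_unit_one W D hpt, zero_add] at h
    exact h.symm
  rw [hab, ha, hb]

/-- the coproduct on the full ring: `m^*` of a degree-one class -/
theorem pullF_m_ι₁ (G : GroupLaw D) (hpt : IsSmoothProjective 0 (𝟙_ (SchemeOver k))) (v : W.obj D.B.X 1) :
    pullF W (P := D.BB) (Q := D.B) D.m (ι₁ W D.B v) =
      pullF W (P := D.BB) (Q := D.B) (fst D.B.X D.B.X) (ι₁ W D.B v) +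
        pullF W (P := D.BB) (Q := D.B) (snd D.B.X D.B.X) (ι₁ W D.B v) := by
  simp only [ι₁, pullF_ofDegF]
  rw [show W.pullback (X := D.BB.X) D.m 1 v = _ from pullback_m_one W D G hpt v]
  exact map_add (ofDegF W D.BB 1) _ _

end groupLaw

end Summit.Ventures.HodgeRepro2.T6.WeilInst

end
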